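import Literature.AnabelianGeometry.EtaleTheta.Discharge.Sec5Thm57GenuineBindersAOfThetaSetting
import Literature.AnabelianGeometry.EtaleTheta.Discharge.Sec2Cor218iThetaSubquotients
import Literature.AnabelianGeometry.EtaleTheta.Discharge.Sec5Thm44HypOfConnectedTemperoidYddTower

/-!
# [EtTh] §5 tower OF THE SETTING: the Prop. 2.4 binder `hP24` of the Thm. 5.7 closers IS the `Π^tp_Ÿ`-clause of the frozen
# FACT Cor. 2.18 (i) (F-0620), and follows from the Prop. 2.4 (i) extension shape (pp. 264, 285–286, 329–331 / PDF pp. 38, 59–60, 103–105)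

Mochizuki, *The étale theta function and its Frobenioid-theoretic manifestations*, Publ. RIMS **45** (2009)
[cite: MochizukiEtTh2009, Cor 2.18 (i) p.285–286 (PDF pp.59–60); Prop 2.4 p.264 (PDF p.38); Thm 5.7 p.329–330 (PDF pp.103–104)].
abc-iut cell, layer L2, seat abc-iut-w5-d123 (gen 5); self-named L-F [EtTh] row «hP24 OF THE THM 5.7 CLOSERS AT THE SETTING TOWER»
(STATUS 2026-08-26T14:33Z, first refusal abc-iut-L6-d6 lineage / abc-iut-L2-d4 / abc-iut-w4-d008).  PROOF-ONLY (0 definitions, 0 new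
named facts; nothing landed is edited or restated).

THE POINT.  Every Thm. 5.7 closer at the genuine connected tower (abc-iut-L2-d4 p442166 / p447315 / p448709, abc-iut-w4-d008's
`exists_thm44Hyp_mkOfConnectedTemperoidYddTower` p446962, this seat's p447915 / p448710 / p449814) carries the binder
`hP24 : ∀ γ : 𝒯.PiX ≃ₜ* 𝒯.PiX, 𝒯.PiYdd.map γ = 𝒯.PiYdd` («every topological automorphism of `Π^tp_X̲` stabilises `Π^tp_Ÿ̲`» — Prop. 2.4 / Cor.
2.18 (i) class).  At the §1 Setting `(X, 𝒯, ιX) := (Π^tp_X̲̲, Cu.thetaEnvTower τ hC hS, id)` the tower's `Π^tp_X̲ = Cu.Huu` and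
`Π^tp_Ÿ̲ = D.GtpYdd.subgroupOf Cu.Huu` (abc-iut-L2-t8's `TowerOfSetting.lean`), so `hP24` is LITERALLY:
* the `Π^tp_Ÿ`-conjunct of abc-iut-L2-t2's frozen named FACT `RigidData.Cor218_i` (FACT-LIST F-0620; [EtTh] Cor. 2.18 (i): «any isomorphism
  … maps [the subquotients `Π^tp_Y`, `Π^tp_Ÿ`, …] to [the corresponding subquotients]») at abc-iut-L2-t8's §1 instantiation
  `Cu.rigidData μ' hC hS h15 L` of the §2 rigidity interface (`RigidOfSetting.lean`; `rigidData_toThetaEnvData` is `rfl`, so its `PiX`,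
  `PiYdd` ARE the tower's, at ANY level datum `(N', μ')`) — `hP24_thetaEnvTower_of_cor218_i`; and
* a consequence of the Prop. 2.4 (i) EXTENSION shape of GAP-LEDGER G-L6d6-2 («every topological automorphism of `Π^tp_X̲̲` extends to one
  of `Π^tp_X` stabilising `Π^tp_Ÿ`») by abc-iut-L2's `map_subgroupOf_Huu_eq_of_extends` (`Sec2Cor218iThetaSubquotients.lean`) —
  `hP24_thetaEnvTower_of_extends`.
(v2, append-only) **`BiKummerSetting.exists_thm44Hyp_ofThetaSettingYddTower_of_cor218_i`** — the OTHER consumer of `hP24`, abc-iut-w4-d008's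
§4-package producer `exists_thm44Hyp_mkOfConnectedTemperoidYddTower` (p446962: `h44` ⟸ {`hnd`, `hshape`, `hΨbs`, `hP24`}), at the Setting with
`hP24` fed by F-0620.  Whence **`thetaRootPreservedAll_ofThetaSettingYddFamily_ofAnchored_genuine_of_cor218_i`** — this seat's Setting capstone of p448710
(`…_ofAnchored_genuine_of_constantsDictionary`: `hN` gone, `hinj`/`hfac₁`/`hgc₁` re-keyed, `hYdd` a theorem) with `hP24` GONE modulo the
frozen FACT F-0620 (named hypothesis `h218i`, D-0067 (5): inputs BY NAME from the FACT list) + abc-iut-L2-t8's §1 inputs `h15 : Prop15iii`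
(FACT-LIST F-0591, [EtTh] Prop. 1.5 (iii)) and the cusp labels `L`.  The L6-side twin of the first item is abc-iut-w4-d013's
`map_gtpYdduu_subgroupOf_eq_of_cor218_i` (`Literature/IUT/HodgeArakelov/EtaleThetaDataOfSettingCor218i.lean`, read through
`GtpYdduu.subgroupOf Huu = GtpYdd.subgroupOf Huu`); it is not imported here (layer order) — the one-line projection is re-derived.
HONEST FRAMING: kernel-checked composition under named hypotheses; F-0620 / `Prop15iii` are FACT-policy assumption labels (nothing of [EtTh]
is asserted); no instance of the class `TemperedFrobenioid T₀ (ConnectedPart (BTemp Π^tp_X̲̲)) VD` for an actual curve is constructed;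
typed ≠ discharged; no side taken on anything downstream ([IUTchIII] Cor. 3.12 in particular). -/

noncomputable section

namespace Literature.AnabelianGeometry.EtaleTheta

open CategoryTheory Opposite Literature.AlgebraicGeometry.Frobenioids Literature.AnabelianGeometry.SemiGraphs
  Literature.AnabelianGeometry.SemiGraphs.GaloisObjects

universe v₀ u₁ v₁

/-! ## `hP24` for the §2 tower of the Setting -/

namespace ThetaSetting.EtaleThetaData.DoubleUnderline

variable {p : ℕ} [Fact p.Prime] {DS : ThetaSetting p} {ES : DS.EtaleThetaData} {l' : ℕ} (Cu : ES.DoubleUnderline l')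
  {Es : Set ℕ+} (τ : DS.CyclotomeTower l' Es) (hC : DS.Compat) (hS : DS.Sec2Hyps)

/-- **`hP24` of the tower closers at the Setting IS the `Π^tp_Ÿ`-clause of the frozen FACT Cor. 2.18 (i)** (F-0620, abc-iut-L2-t2's
`RigidData.Cor218_i`) at abc-iut-L2-t8's `Cu.rigidData μ' hC hS h15 L` — any level datum `(N', μ')`: every topological automorphism of
`Π^tp_X̲̲ = Cu.Huu` stabilises `Π^tp_Ÿ̲̲ = D.GtpYdd.subgroupOf Cu.Huu` (the tower's `PiYdd`, definitionally).
[cite: MochizukiEtTh2009, Cor 2.18 (i) p.285–286 (PDF pp.59–60)] -/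
theorem hP24_thetaEnvTower_of_cor218_i {N' : ℕ+} (μ' : DS.CyclotomeMod l' N') (h15 : DS.Prop15iii ES hC) (L : Cu.CuspLabels)
    (h218i : (Cu.rigidData μ' hC hS h15 L).Cor218_i) :
    ∀ γ : (Cu.thetaEnvTower τ hC hS).PiX ≃ₜ* (Cu.thetaEnvTower τ hC hS).PiX,
      (Cu.thetaEnvTower τ hC hS).PiYdd.map γ.toMulEquiv.toMonoidHom = (Cu.thetaEnvTower τ hC hS).PiYdd :=
  fun γ => (h218i γ).2.1

/-- **`hP24` of the tower closers at the Setting from the Prop. 2.4 (i) EXTENSION shape** (GAP-LEDGER G-L6d6-2: every topological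
automorphism `γ` of `Π^tp_X̲̲` extends to a topological automorphism `Γ` of `Π^tp_X` with `Γ(Π^tp_Ÿ) = Π^tp_Ÿ`), by abc-iut-L2's
`map_subgroupOf_Huu_eq_of_extends`.  [cite: MochizukiEtTh2009, Prop 2.4 p.264 (PDF p.38)] -/
theorem hP24_thetaEnvTower_of_extends
    (hP24ext : ∀ γ : Cu.Huu ≃ₜ* Cu.Huu, ∃ Γ : DS.PiTemp ≃ₜ* DS.PiTemp,
      (∀ h : Cu.Huu, (Γ h : DS.PiTemp) = γ h) ∧ DS.GtpYdd.map Γ.toMulEquiv.toMonoidHom = DS.GtpYdd) :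
    ∀ γ : (Cu.thetaEnvTower τ hC hS).PiX ≃ₜ* (Cu.thetaEnvTower τ hC hS).PiX,
      (Cu.thetaEnvTower τ hC hS).PiYdd.map γ.toMulEquiv.toMonoidHom = (Cu.thetaEnvTower τ hC hS).PiYdd := by
  intro γ
  obtain ⟨Γ, hΓ, hYdd⟩ := hP24ext γ
  exact Cu.map_subgroupOf_Huu_eq_of_extends γ Γ hΓ _ hYdd

end ThetaSetting.EtaleThetaData.DoubleUnderline

/-! ## The Setting capstone with `hP24` re-keyed to F-0620 -/

namespace ThetaFrobenioidTower

section Setting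

variable {p : ℕ} [Fact p.Prime] {DS : ThetaSetting p} {ES : DS.EtaleThetaData} {l' : ℕ} {Cu : ES.DoubleUnderline l'}
  {e' : DS.toTemperedCurve.GroupLevelData} {Es : Set ℕ+} (τ : DS.CyclotomeTower l' Es) (hC : DS.Compat) (hS : DS.Sec2Hyps)
  {D₀ : Type} [Category.{v₀} D₀] {V : FrdIMonoidStub.{0}} {T₀ : RealifiedDivisorMonoids (D₀ := D₀) V}
  {VD : FrdICatStub.{1, 0, 0} (ConnectedPart (BTemp (Cu.temperedArithmeticGroup e').Pi))}
  {tf : TemperedFrobenioid T₀ (ConnectedPart (BTemp (Cu.temperedArithmeticGroup e').Pi)) VD} {hZ : tf.monoidType = MonoidType.Z}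
  {hP : ∀ A : (ConnectedPart (BTemp (Cu.temperedArithmeticGroup e').Pi))ᵒᵖ, IsPerfect (tf.Φ.carrier A)}
  {NH : Subgroup (Field.absoluteGaloisGroup DS.K) → tf.category → ℕ+ → Prop}
  {pullFrac : ∀ {A A' : (BiKummerSetting.mkOfConnectedTemperoidYddTower (Cu.temperedArithmeticGroup e') tf hZ hP NH
      (Cu.thetaEnvTower τ hC hS) (ContinuousMulEquiv.refl _)).C} (_ : A' ⟶ A),
    (BiKummerSetting.mkOfConnectedTemperoidYddTower (Cu.temperedArithmeticGroup e') tf hZ hP NH (Cu.thetaEnvTower τ hC hS)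
        (ContinuousMulEquiv.refl _)).biratUnits A →
      (BiKummerSetting.mkOfConnectedTemperoidYddTower (Cu.temperedArithmeticGroup e') tf hZ hP NH (Cu.thetaEnvTower τ hC hS)
        (ContinuousMulEquiv.refl _)).biratUnits A'}
  {θ : (BiKummerSetting.mkOfConnectedTemperoidYddTower (Cu.temperedArithmeticGroup e') tf hZ hP NH (Cu.thetaEnvTower τ hC hS)
      (ContinuousMulEquiv.refl _)).biratUnits
    (BiKummerSetting.mkOfConnectedTemperoidYddTower (Cu.temperedArithmeticGroup e') tf hZ hP NH (Cu.thetaEnvTower τ hC hS)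
      (ContinuousMulEquiv.refl _)).Aodot}
  {Bl : (BiKummerSetting.mkOfConnectedTemperoidYddTower (Cu.temperedArithmeticGroup e') tf hZ hP NH (Cu.thetaEnvTower τ hC hS)
      (ContinuousMulEquiv.refl _)).C}
  {Pl : (BiKummerSetting.mkOfConnectedTemperoidYddTower (Cu.temperedArithmeticGroup e') tf hZ hP NH (Cu.thetaEnvTower τ hC hS)
      (ContinuousMulEquiv.refl _)).FractionPair θ Bl}
  {Rl : (BiKummerSetting.mkOfConnectedTemperoidYddTower (Cu.temperedArithmeticGroup e') tf hZ hP NH (Cu.thetaEnvTower τ hC hS)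
      (ContinuousMulEquiv.refl _)).NthRoot θ Pl Cu.lPNat pullFrac}
  (h : ModelFrobenioid.Hypotheses tf.divisorMonoid tf.ratFnFunctor)
  (Q : FrobenioidTheta.ThetaSubquotientStub.{0} (ConnectedPart (BTemp (Cu.temperedArithmeticGroup e').Pi)))
  (R : ∀ N : ℕ+, (BiKummerSetting.mkOfConnectedTemperoidYddTower (Cu.temperedArithmeticGroup e') tf hZ hP NH
      (Cu.thetaEnvTower τ hC hS) (ContinuousMulEquiv.refl _)).NthRoot Rl.root Rl.pair N pullFrac)
  (K' : Type) [Field K'] {X₀ : ConnectedPart (BTemp (Cu.temperedArithmeticGroup e').Pi)}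
  (hX₀ : ∀ Y : ConnectedPart (BTemp (Cu.temperedArithmeticGroup e').Pi), Subsingleton (Y ⟶ X₀))
  (t : ∀ N : ℕ+, (R N).BN.base ⟶ X₀) (c₀ : K'ˣ →* (tf.ratFnFunctor.obj (op X₀))ˣ)
  (hc₀ : Function.Injective c₀) (ht : ∀ N : ℕ+, Function.Injective (tf.ratFnFunctor.map (t N).op).hom)
  (hinvc : ∀ (N : ℕ+) (g : Aut (R N).AN.base),
    pull tf.divisorMonoid g.hom (ModelFrobenioid.div (R N).pair.num) = ModelFrobenioid.div (R N).pair.num)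
  (hinvp : ∀ (N : ℕ+) (y : (Cu.thetaEnvTower τ hC hS).PiX), y ∈ (Cu.thetaEnvTower τ hC hS).PiYdd →
    pull tf.divisorMonoid ((BiKummerSetting.mkOfConnectedTemperoidYddTower (Cu.temperedArithmeticGroup e') tf hZ hP NH
      (Cu.thetaEnvTower τ hC hS) (ContinuousMulEquiv.refl _)).galoisSurj (R N).AN.base (R N).αData.isGalois
        ((ContinuousMulEquiv.refl _) y)).hom (ModelFrobenioid.div (R N).pair.den) = ModelFrobenioid.div (R N).pair.den)
  (α : ∀ {N N' : ℕ+}, (N : ℕ) ∣ N' → ((R N').AN ⟶ (R N).AN))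
  (β : ∀ {N N' : ℕ+}, (N : ℕ) ∣ N' → ((R N').BN ⟶ (R N).BN))
  (comm_sCap : ∀ {N N' : ℕ+} (hd : (N : ℕ) ∣ N'), (R N').pair.num ≫ β hd = α hd ≫ (R N).pair.num)
  (comm_sCup : ∀ {N N' : ℕ+} (hd : (N : ℕ) ∣ N'), (R N').pair.den ≫ β hd = α hd ≫ (R N).pair.den)
  (isIsometry_α : ∀ {N N' : ℕ+} (hd : (N : ℕ) ∣ N'),
    ((BiKummerSetting.mkOfConnectedTemperoidYddTower (Cu.temperedArithmeticGroup e') tf hZ hP NH (Cu.thetaEnvTower τ hC hS)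
      (ContinuousMulEquiv.refl _)).sec5Stub h).pre.IsIsometry (α hd))
  (degFr_α : ∀ {N N' : ℕ+} (hd : (N : ℕ) ∣ N'),
    (((BiKummerSetting.mkOfConnectedTemperoidYddTower (Cu.temperedArithmeticGroup e') tf hZ hP NH (Cu.thetaEnvTower τ hC hS)
      (ContinuousMulEquiv.refl _)).sec5Stub h).pre.degFr (α hd) : ℕ) * N = N')
  (isIsometry_β : ∀ {N N' : ℕ+} (hd : (N : ℕ) ∣ N'),
    ((BiKummerSetting.mkOfConnectedTemperoidYddTower (Cu.temperedArithmeticGroup e') tf hZ hP NH (Cu.thetaEnvTower τ hC hS)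
      (ContinuousMulEquiv.refl _)).sec5Stub h).pre.IsIsometry (β hd))
  (degFr_β : ∀ {N N' : ℕ+} (hd : (N : ℕ) ∣ N'),
    (((BiKummerSetting.mkOfConnectedTemperoidYddTower (Cu.temperedArithmeticGroup e') tf hZ hP NH (Cu.thetaEnvTower τ hC hS)
      (ContinuousMulEquiv.refl _)).sec5Stub h).pre.degFr (β hd) : ℕ) * N = N')
  (baseFrob_α : ∀ {N N' : ℕ+} (hd : (N : ℕ) ∣ N'),
    (BiKummerSetting.mkOfConnectedTemperoidYddTower (Cu.temperedArithmeticGroup e') tf hZ hP NH (Cu.thetaEnvTower τ hC hS)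
      (ContinuousMulEquiv.refl _)).IsOfBaseFrobeniusType (α hd))

include hX₀ h hc₀ ht in
/-- **[EtTh] Theorem 5.7 (root level) at ALL levels for the tower OF THE SETTING, anchored form, with `hP24` RE-KEYED to the frozen FACT
Cor. 2.18 (i)**: this seat's `…_ofThetaSettingYddFamily_ofAnchored_genuine_of_constantsDictionary` (p448710: `hN` gone, `hinj` ⟸ {`hc₀`,
`ht`}, `hfac₁` ⟸ {`hP34`, `ecn`} with `hYdd` a theorem, `hgc₁` ⟸ {`hD₁`, `hY₁`}) with the (anchor) binder `hP24` SUPPLIED by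
`hP24_thetaEnvTower_of_cor218_i` from `h218i : (Cu.rigidData μ' hC hS h15 L).Cor218_i` (F-0620, by name).  RESIDUAL: `hnd` (abstract
vocabulary; gone at the canonical ones, p448710/p449814), the junction data of record, seeds `αs βs hdivcap₁ hdivcup₁`, `hfam`, (C) `hc`, and
the FACT inputs `h218i` (F-0620) / `h15` (`Prop15iii`, F-0591) / cusp labels `L`.
[cite: MochizukiEtTh2009, Thm 5.7 p.329–330 (PDF pp.103–104); Cor 2.18 (i) p.285–286 (PDF pp.59–60); Lem 5.8 p.331 (PDF p.105)] -/
theorem thetaRootPreservedAll_ofThetaSettingYddFamily_ofAnchored_genuine_of_cor218_i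
    (T : ThetaFrobenioidTower.{0} (BiKummerSetting.mkOfConnectedTemperoidYddTower (Cu.temperedArithmeticGroup e') tf hZ hP NH
      (Cu.thetaEnvTower τ hC hS) (ContinuousMulEquiv.refl _)).C (ConnectedPart (BTemp (Cu.temperedArithmeticGroup e').Pi)))
    (hT : T = ofThetaSettingFamily τ hC hS h Q R K' (fun N => (Units.map (tf.ratFnFunctor.map (t N).op).hom).comp c₀)
      (fun N => tf.unitsMap_comp_injective (t N) hc₀ (ht N)) hinvc hinvp α β comm_sCap comm_sCup isIsometry_α degFr_α
      isIsometry_β degFr_β baseFrob_α)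
    -- (A), residual: print's standing hypothesis "`Φ` non-dilating" (Thm. 3.7 (ii) / Cor. 3.8)
    (hnd : IsNonDilatingOn tf.divisorMonoid)
    -- (A) `hgc₁` RE-KEYED: the ONE junction binder at the first root and the identification of `Π^tp_Y̲`
    {μ₁ : DS.CyclotomeMod l' (T.atLevel 1).N} {ι₁ : (T.atLevel 1).PiX ≃ₜ* (Cu.thetaEnvData μ₁ hC hS).PiX}
    {m₁ : (T.atLevel 1).muTorsion (T.atLevel 1).BN (T.atLevel 1).N ≃* (Cu.thetaEnvData μ₁ hC hS).mu}
    (α₁ : (T.atLevel 1).BiratAutAction) {Cst₁ : Subgroup ((T.atLevel 1).biratUnits (T.atLevel 1).BN)}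
    {ν₁ : Cst₁ →* (PadicAlgCl p)ˣ}
    (hD₁ : ThetaFrobenioid.BiratAutAction.ConstantsDictionary α₁ Cu μ₁ hC hS ι₁ m₁ Cst₁ ν₁)
    (hY₁ : (T.atLevel 1).IdentifiesPiY (Cu.thetaEnvData μ₁ hC hS) ι₁.toMulEquiv)
    (Ψ : (BiKummerSetting.mkOfConnectedTemperoidYddTower (Cu.temperedArithmeticGroup e') tf hZ hP NH (Cu.thetaEnvTower τ hC hS)
        (ContinuousMulEquiv.refl _)).C ≌
      (BiKummerSetting.mkOfConnectedTemperoidYddTower (Cu.temperedArithmeticGroup e') tf hZ hP NH (Cu.thetaEnvTower τ hC hS)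
        (ContinuousMulEquiv.refl _)).C)
    -- (A) `hfac₁` RE-KEYED: Prop. 3.4 (ii) and the identification `D → D₀ → D^cnst ≅ aug_* ⋙ G` (`hYdd` is a theorem here)
    {Dcnst : Type u₁} [Category.{v₁} Dcnst] (cnst : D₀ ⥤ Dcnst)
    (G : ConnectedPart (BTemp (Field.absoluteGaloisGroup DS.K)) ⥤ Dcnst)
    (ecn : tf.base ⋙ cnst ≅ QuasiTemperoid.pushforward (Cu.temperedArithmeticGroup e').aug.toMonoidHom
      (Cu.temperedArithmeticGroup e').aug_surjective (Cu.temperedArithmeticGroup e').augIsOpenMap_holds ⋙ G)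
    (hP34 : RealifiedDivisorMonoids.Prop34Cnst T₀ cnst)
    -- the seeds of the anchor at the first root [Thm. 5.10 (i)] and the inputs of abc-iut-w5-d245's producer
    (αs : Ψ.functor.obj (T.AN 1) ≅ T.AN 1) (βs : Ψ.functor.obj (T.BN 1) ≅ T.BN 1)
    (hdivcap₁ : T.pre.div (αs.inv ≫ Ψ.functor.map (T.sCap 1) ≫ βs.hom) = T.pre.div (T.sCap 1))
    (hdivcup₁ : T.pre.div (αs.inv ≫ Ψ.functor.map (T.sCup 1) ≫ βs.hom) = T.pre.div (T.sCup 1))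
    -- (anchor) `hP24` RE-KEYED to the frozen FACT F-0620 ([EtTh] Cor. 2.18 (i)) at abc-iut-L2-t8's `Cu.rigidData μ' hC hS h15 L`
    {N' : ℕ+} (μ' : DS.CyclotomeMod l' N') (h15 : DS.Prop15iii ES hC) (L : Cu.CuspLabels)
    (h218i : (Cu.rigidData μ' hC hS h15 L).Cor218_i)
    -- the coherent family, for every normalised anchor (abc-iut-f-121's p438241 output shape)
    (hfam : ∀ (α₁ : Ψ.functor.obj (T.AN 1) ≅ T.AN 1) (β₁ : Ψ.functor.obj (T.BN 1) ≅ T.BN 1) (u₁ : Aut (T.BN 1)),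
      u₁ ∈ (T.atLevel 1).units (T.BN 1) →
      α₁.inv ≫ Ψ.functor.map (T.sCap 1) ≫ β₁.hom = T.sCap 1 →
      α₁.inv ≫ Ψ.functor.map (T.sCup 1) ≫ β₁.hom = T.sCup 1 ≫ u₁.hom →
        ∀ N : ℕ+, ∃ (a : Ψ.functor.obj (T.AN N) ≅ T.AN N) (b : Ψ.functor.obj (T.BN N) ≅ T.BN N) (w : Aut (T.BN N)),
          w ∈ (T.atLevel N).units (T.BN N) ∧
          a.inv ≫ Ψ.functor.map (T.sCap N) ≫ b.hom = T.sCap N ∧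
          a.inv ≫ Ψ.functor.map (T.sCup N) ≫ b.hom = T.sCup N ≫ w.hom ∧
          a.inv ≫ Ψ.functor.map (T.α (one_dvd_level N)) ≫ α₁.hom = T.α (one_dvd_level N) ∧
          b.inv ≫ Ψ.functor.map (T.β (one_dvd_level N)) ≫ β₁.hom = T.β (one_dvd_level N))
    -- (C): the level-1 discrepancy constant of every normalised transport is a `2l`-th root of unity
    (hc : ∀ (α₁ : Ψ.functor.obj (T.AN 1) ≅ T.AN 1) (β₁ : Ψ.functor.obj (T.BN 1) ≅ T.BN 1) (u₁ : Aut (T.BN 1))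
      (hu₁ : u₁ ∈ (T.atLevel 1).units (T.BN 1)),
      α₁.inv ≫ Ψ.functor.map (T.sCap 1) ≫ β₁.hom = T.sCap 1 →
      α₁.inv ≫ Ψ.functor.map (T.sCup 1) ≫ β₁.hom = T.sCup 1 ≫ u₁.hom →
        ∀ c : T.Kˣ, (T.atLevel 1).unitsToBirat (T.BN 1) ⟨u₁, hu₁⟩ = T.constEmb 1 c → c ^ (2 * T.l) = 1) :
    T.ThetaRootPreservedAll Ψ :=
  thetaRootPreservedAll_ofThetaSettingYddFamily_ofAnchored_genuine_of_constantsDictionary τ hC hS h Q R K' hX₀ t c₀ hc₀ ht hinvc hinvp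
    α β comm_sCap comm_sCup isIsometry_α degFr_α isIsometry_β degFr_β baseFrob_α T hT hnd α₁ hD₁ hY₁ Ψ cnst G ecn hP34 αs βs hdivcap₁
    hdivcup₁ (Cu.hP24_thetaEnvTower_of_cor218_i τ hC hS μ' h15 L h218i) hfam hc

end Setting

end ThetaFrobenioidTower

/-! ## v2 (append-only): `h44` at the Setting with `hP24` re-keyed to F-0620 — abc-iut-w4-d008's FILE 5 at `(Π^tp_X̲̲, Cu.thetaEnvTower τ hC hS, id)` -/

namespace BiKummerSetting

variable {p : ℕ} [Fact p.Prime] {DS : ThetaSetting p} {ES : DS.EtaleThetaData} {l' : ℕ} (Cu : ES.DoubleUnderline l')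
  {e' : DS.toTemperedCurve.GroupLevelData} {Es : Set ℕ+} (τ : DS.CyclotomeTower l' Es) (hC : DS.Compat) (hS : DS.Sec2Hyps)
  {D₀ : Type} [Category.{v₀} D₀] {V : FrdIMonoidStub.{0}} {T₀ : RealifiedDivisorMonoids (D₀ := D₀) V}
  {VD : FrdICatStub.{1, 0, 0} (ConnectedPart (BTemp (Cu.temperedArithmeticGroup e').Pi))}
  (tf : TemperedFrobenioid T₀ (ConnectedPart (BTemp (Cu.temperedArithmeticGroup e').Pi)) VD) (hZ : tf.monoidType = MonoidType.Z)
  (hP : ∀ A : (ConnectedPart (BTemp (Cu.temperedArithmeticGroup e').Pi))ᵒᵖ, IsPerfect (tf.Φ.carrier A))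
  (NH : Subgroup (Field.absoluteGaloisGroup DS.K) → tf.category → ℕ+ → Prop)

/-- **The §4 package binder `h44 : Thm44Hyp S S` of the Thm. 5.7 closers AT THE SETTING, with its Prop. 2.4 input `hP24` SUPPLIED by the
frozen FACT Cor. 2.18 (i)** (F-0620): abc-iut-w4-d008's `exists_thm44Hyp_mkOfConnectedTemperoidYddTower` (p446962; `h44` ⟸ {`hnd`, `hshape`,
`hΨbs`, `hP24`}) at `S := mkOfConnectedTemperoidYddTower Π^tp_X̲̲ tf hZ hP NH (Cu.thetaEnvTower τ hC hS) id`, fed with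
`hP24_thetaEnvTower_of_cor218_i` — so at the Setting `h44` ⟸ {`hnd`, `hshape`, `hΨbs`, `h218i` (F-0620), `h15` (F-0591), `L`}.
[cite: MochizukiEtTh2009, Thm 4.4 p.319 (PDF p.93); Cor 2.18 (i) p.285–286 (PDF pp.59–60)] -/
theorem exists_thm44Hyp_ofThetaSettingYddTower_of_cor218_i (Ψ : tf.category ≌ tf.category)
    (hnd : ∀ (A : (ConnectedPart (BTemp (Cu.temperedArithmeticGroup e').Pi))ᵒᵖ) (φ : A ⟶ A),
      V.IsNonDilating (tf.Φ.carrier A) (tf.Φ.pull φ))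
    (hshape : tf.base.Full ∧ tf.base.Faithful ∧
      ∃ 𝒟 : D₀, ∀ Y : D₀, (∃ A : ConnectedPart (BTemp (Cu.temperedArithmeticGroup e').Pi), Nonempty (tf.base.obj A ≅ Y)) ↔
        Nonempty (Y ⟶ 𝒟))
    (hΨbs : ∃ Ψbs : ConnectedPart (BTemp (Cu.temperedArithmeticGroup e').Pi) ≌ ConnectedPart (BTemp (Cu.temperedArithmeticGroup e').Pi),
      Nonempty ((mkOfConnectedTemperoidYddTower (Cu.temperedArithmeticGroup e') tf hZ hP NH (Cu.thetaEnvTower τ hC hS)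
        (ContinuousMulEquiv.refl _)).base ⋙ Ψbs.functor ≅
        Ψ.functor ⋙ (mkOfConnectedTemperoidYddTower (Cu.temperedArithmeticGroup e') tf hZ hP NH (Cu.thetaEnvTower τ hC hS)
          (ContinuousMulEquiv.refl _)).base))
    {N' : ℕ+} (μ' : DS.CyclotomeMod l' N') (h15 : DS.Prop15iii ES hC) (L : Cu.CuspLabels)
    (h218i : (Cu.rigidData μ' hC hS h15 L).Cor218_i) :
    ∃ hh : Thm44Hyp
        (mkOfConnectedTemperoidYddTower (Cu.temperedArithmeticGroup e') tf hZ hP NH (Cu.thetaEnvTower τ hC hS)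
          (ContinuousMulEquiv.refl _))
        (mkOfConnectedTemperoidYddTower (Cu.temperedArithmeticGroup e') tf hZ hP NH (Cu.thetaEnvTower τ hC hS)
          (ContinuousMulEquiv.refl _)),
      hh.Ψ = Ψ :=
  exists_thm44Hyp_mkOfConnectedTemperoidYddTower (Cu.temperedArithmeticGroup e') tf hZ hP NH (Cu.thetaEnvTower τ hC hS)
    (ContinuousMulEquiv.refl _) Ψ hnd hshape hΨbs (Cu.hP24_thetaEnvTower_of_cor218_i τ hC hS μ' h15 L h218i)

end BiKummerSetting

end Literature.AnabelianGeometry.EtaleTheta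

end
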